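import Literature.NumberTheory.Automorphic.Liu2021.SplitPlaceHeckeEigenvaluesQuadExtPackage
import Literature.NumberTheory.Automorphic.UnitaryGroupLocalLineHeckeTransport
import Literature.NumberTheory.GelbartRogawski1991.LocalUnitarySplittingsCMExplicit
import Literature.NumberTheory.GelbartRogawski1991.UndoublingPlaceAssembly
import HarnessLib

/-!
# [Liu2021, Lemma D.1 (2)] at a split place, read on `U(J_V)(F_v)` through the line embedding `k ↦ k ⊗ 1`:
# the local Hecke eigen-equations of the `χ_v`-coinvariants of `ω_v ∘ s_v` pulled back along `localLineInl v`, `ν = θ_w`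

Topic `Literature/NumberTheory/Automorphic/Liu2021`; proof file (theorems only: no definition, no named fact, no instance, no
`sorry`); count-neutral.

For the dual pair `U(V) × U(W)` with `W` a hermitian LINE ([Liu2021, App. D §D.1]: `U(V ⊗ W) = U(V)`), the representation of
`U(J_V)(F_v)` that [Liu2021, Def. 4.11]'s `ω(μ, ε, χ)` carries at a finite place `v` is the `χ_v`-coinvariant quotient of
the local Weil representation `ω_v ∘ s_v` of the rank-`2` group `U(J_{VW})(F_v)`, `J_{VW} = reindex e e (J_V ⊗ₖ J_W)`, under the
centre `U(J_W)(F_v)`, PULLED BACK along `localLineInl v : U(J_V)(F_v) → U(J_{VW})(F_v)`.  For THE CM section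
`s_v = localSplittingCM L 2 … θ hθ v` the eigen-equations in `U(J_{VW})`-currency are ★
`splitPlace_heckeOperator_localInt_apply_localSplittingCM` (`ν = θ_w`); ★ `heckeOperator_comp_localLineInl_apply_eq_smul₂`
transports them to `U(J_V)`-currency.  This file composes the two:

* `splitPlace_heckeOperator_localInt_apply_localSplittingCM_comp_localLineInl` — for `s = localSplittingCM L 2 hT₀ hT₀d hJ θ hθ v`
  (hypothesis `hs`, `s` a variable so that consumers instantiate by `rfl`-like identities), on every
  `U(J_V)(𝒪_v)`-fixed vector of `(χc-coinvariants of ω_v ∘ s) ∘ localLineInl v`: the operators of `e_w^{V,-1}(diag(ϖ, 1))`,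
  `e_w^{V,-1}(diag(ϖ, ϖ))` act by `q_w^{1/2}(θ_w(ϖ) + χ′(ϖ)θ_w(ϖ)⁻¹)` and `χ′(ϖ)`;
* `congrW_undoubledSplittings_cmFinLocalFamily_s` — the section at `v` of the consumers' family
  `congrW hT hJ (undoubledSplittings θ (borelPlaceMeasure L) (cmFinLocalFamily θ hθ (borelPlaceMeasure L)))` IS
  `localSplittingCM L n … θ hθ v` (`subst`; `undoubleLoc_finSplittings_s_cmFinLocalFamily`, `rfl`) — the `hs` above for the
  `θ`-package of `Def411WeilCarriers.exists_isRestrictedTensorProductRep_chiSplittingLine_omegaPi_center`.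

Written for the d6 line of cell `hodgecm-mathlib` (card S4, «S4c-L»); HC_CM is NOT proved by anything here.

## References
* Y. Liu, *Fourier–Jacobi cycles and arithmetic relative trace formula*, Cambridge J. Math. 9 (2021), App. D,
  Lemma D.1 (2) and its proof (first paragraph), p. 126; App. D §D.1 (l. 5213–5224). [Liu2021]
* S. Gelbart, J. Rogawski, Invent. Math. 105 (1991), §3.1 Prop. 3.1.1 p. 455; §3.2 p. 457. [GelbartRogawski1991]
* P. Cartier, PSPM 33 (1979), part 1, §IV.1. [CartierCorvallis1979]
-/

set_option autoImplicit false

noncomputable section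

open scoped Matrix Kronecker
open NumberField IsDedekindDomain Matrix
open _root_.MeasureTheory
open scoped MatrixGroups
open ValuativeRel
open Literature.RepresentationTheory (TwistedCoinv.rep TwistedCoinv.Coinv TwistedCoinv.mk)
open Literature.RepresentationTheory.HeisenbergGroup (MpPsi)
open Literature.NumberTheory.Automorphic.Zelevinsky1980 (lastBlockLabel)
open Literature.NumberTheory.Automorphic Literature.NumberTheory.Automorphic.UnitaryGroup
open Literature.NumberTheory.GelbartRogawski1991.UnitaryDualPair
open Literature.NumberTheory.GelbartRogawski1991.UnitaryDualPair.LocalSplitting (localSchrodinger localSplittingCM LocalMp)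
open Literature.NumberTheory.GelbartRogawski1991.GRConstruction
open Literature.RepresentationTheory.HarrisKudlaSweet1996 Literature.NumberTheory.GaloisRepresentations

/-! ## §1 The section at `v` of the consumers' `θ`-family is `localSplittingCM` -/

namespace Literature.NumberTheory.GelbartRogawski1991.GRConstruction

/-- **the section at `v` of `congrW hT hJ (undoubledSplittings θ (borelPlaceMeasure L) (cmFinLocalFamily θ hθ (borelPlaceMeasure L)))`
IS `localSplittingCM L n … θ hθ v`** (Haar data of record; `congrW` is a transport along `hT`, `hJ` — `subst` — and the
undoubled CM package at `v` is `localSplittingCM` by `undoubleLoc_finSplittings_s_cmFinLocalFamily`, `rfl`).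
[cite: GelbartRogawski1991, §3.1 Prop. 3.1.1 p. 455 L1–3] -/
theorem congrW_undoubledSplittings_cmFinLocalFamily_s (L : Type) [Field L] [NumberField L] [IsCMField L]
    {N M n : ℕ} (e : Fin N × Fin M ≃ Fin n)
    (dV : Fin N → L) (hdV : ∀ i, IsCMField.complexConj L (dV i) = dV i) (hdV0 : ∀ i, dV i ≠ 0)
    (dW : Fin M → L) (hdW : ∀ i, IsCMField.complexConj L (dW i) = dW i) (hdW0 : ∀ i, dW i ≠ 0)
    {TW' : Matrix (Fin M) (Fin M) (Fp L)} {JW' : Matrix (Fin M) (Fin M) L}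
    (hT : realDiagonal L dW hdW = TW') (hJ : Matrix.diagonal dW = JW') (hW' : TW'.IsSymm) (hW'd : IsUnit TW'.det)
    (hJW' : JW' = TW'.map (algebraMap (Fp L) L))
    (θ : HeckeCharacter L) (hθ : IsSplittingChar L 1 θ) (v : HeightOneSpectrum (𝓞 (Fp L))) :
    (congrW L e dV hdV dW hdW hT hJ
        (undoubledSplittings L e dV hdV hdV0 dW hdW hdW0 θ (borelPlaceMeasure L)
          (cmFinLocalFamily L e dV hdV hdV0 dW hdW hdW0 θ hθ (borelPlaceMeasure L))) hW' hJW').s v =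
      localSplittingCM L n (T₀ := gram (Fp L) e (realDiagonal L dV hdV) TW')
        (isSymm_gram (Fp L) e (realDiagonal_isSymm L dV hdV) hW')
        (isUnit_det_gram (Fp L) e (isUnit_det_realDiagonal L dV hdV hdV0) hW'd)
        (reindex_kronecker_eq_gram_map (Fp L) L e (realDiagonal_map L dV hdV).symm hJW') θ hθ v := by
  subst hT hJ
  rfl

end Literature.NumberTheory.GelbartRogawski1991.GRConstruction

/-! ## §2 The eigen-equations on `U(J_V)(F_v)` through `localLineInl v` -/

namespace Literature.NumberTheory.Automorphic.Liu2021

set_option maxHeartbeats 2000000 in -- as in `SplitPlaceHeckeEigenvaluesQuadExtPackage`: the explicit model's ≈ 40 heavy binders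
/-- **[Liu2021, Lem. D.1 (2)] at a split place for THE CM PACKAGE, read on `U(J_V)(F_v)` through `k ↦ k ⊗ 1`, `ν = θ_w`.**
Data: a CM field `L/L⁺` (`c` = complex conjugation), `J_V ∈ GL₂(L)` hermitian, a hermitian LINE `J_W` (`J_W 0 0 ≠ 0`),
`J_{VW} = reindex finProdFinEquiv finProdFinEquiv (J_V ⊗ₖ J_W) = T₀ ⊗ 1` with `T₀ = diag t ∈ GL₂(L⁺)`, a unitary splitting
character `θ` (`IsSplittingChar L 1 θ`), a place `v` of `L⁺` split in `L`, ANY `w ∣ v` with `c • w ≠ w` (`J_V`, `J_{VW}` invertible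
at `w`, `J_{VW}` of good reduction at `w`), a unitary continuous character `χc` of the centre `U(J_W)(F_v)` with `w`-reading `χ′`,
a uniformiser `ϖ` of `L_w`, and `s = localSplittingCM L 2 hT₀ hT₀d hJ θ hθ v` (hypothesis `hs`).  Conclusion: on every
`U(J_V)(𝒪_v)`-fixed vector `y` of `(χc-coinvariants of ω_v ∘ s under U(J_W)(F_v)) ∘ localLineInl v`, the double coset operators
of `e_w^{V,-1}(diag(ϖ, 1))` and `e_w^{V,-1}(diag(ϖ, ϖ))` act by `q_w^{1/2}(θ_w(ϖ) + χ′(ϖ)θ_w(ϖ)⁻¹)` and by `χ′(ϖ)`.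
Proof: ★ `splitPlace_heckeOperator_localInt_apply_localSplittingCM` (the equations in `U(J_{VW})`-currency) ∘ ★
`heckeOperator_comp_localLineInl_apply_eq_smul₂` (transport along the surjection `localLineInl v`).
[cite: Liu2021, App. D, Lemma D.1 (2) and proof of Lemma D.1 (first paragraph), p. 126]
[cite: GelbartRogawski1991, §3.2 p. 457] [cite: CartierCorvallis1979, §IV.1] -/
theorem splitPlace_heckeOperator_localInt_apply_localSplittingCM_comp_localLineInl
    (L : Type) [Field L] [NumberField L] [IsCMField L] (hc1 : IsCMField.complexConj L ≠ 1)
    (JV : Matrix (Fin 2) (Fin 2) L) (JW : Matrix (Fin 1) (Fin 1) L) (hJW0 : JW 0 0 ≠ 0)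
    (T₀ : Matrix (Fin 2) (Fin 2) (maximalRealSubfield L)) (hT₀ : T₀.IsSymm) (hT₀d : IsUnit T₀.det)
    (t : Fin 2 → maximalRealSubfield L) (hT₀t : T₀ = Matrix.diagonal t)
    (hJ : Matrix.reindex (finProdFinEquiv : Fin 2 × Fin 1 ≃ Fin 2) finProdFinEquiv (JV ⊗ₖ JW) =
      T₀.map (algebraMap (maximalRealSubfield L) L))
    (hJVh : (JV.map (IsCMField.complexConj L))ᵀ = JV)
    (hJh : ((Matrix.reindex (finProdFinEquiv : Fin 2 × Fin 1 ≃ Fin 2) finProdFinEquiv (JV ⊗ₖ JW)).map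
      (IsCMField.complexConj L))ᵀ = Matrix.reindex (finProdFinEquiv : Fin 2 × Fin 1 ≃ Fin 2) finProdFinEquiv (JV ⊗ₖ JW))
    (v : HeightOneSpectrum (𝓞 (maximalRealSubfield L))) (w : UnitaryGroup.PlacesOver L v)
    (hw : IsCMField.complexConj L • (w : HeightOneSpectrum (𝓞 L)) ≠ w)
    (hJVw : IsUnit (UnitaryGroup.placeForm JV (w : HeightOneSpectrum (𝓞 L))))
    (hJw : IsUnit (UnitaryGroup.placeForm
      (Matrix.reindex (finProdFinEquiv : Fin 2 × Fin 1 ≃ Fin 2) finProdFinEquiv (JV ⊗ₖ JW)) (w : HeightOneSpectrum (𝓞 L))))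
    (hJi : hJw.unit ∈ glInt 2 ((w : HeightOneSpectrum (𝓞 L)).adicCompletion L))
    (θ : HeckeCharacter L) (hθ : IsSplittingChar L 1 θ) (hθu : θ.IsUnitary)
    (s : UnitaryGroup.localPi L (IsCMField.complexConj L) 2
        (Matrix.reindex (finProdFinEquiv : Fin 2 × Fin 1 ≃ Fin 2) finProdFinEquiv (JV ⊗ₖ JW)) v →*
      LocalMp (maximalRealSubfield L) 2 T₀ v)
    (hs : s = localSplittingCM L 2 hT₀ hT₀d hJ θ hθ v)
    [LocallyCompactSpace (standardParabolicGL ((w : HeightOneSpectrum (𝓞 L)).adicCompletion L)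
      (Zelevinsky1980.lastBlockLabel 2))]
    (χc : UnitaryGroup.localPi L (IsCMField.complexConj L) 1 JW v →* ℂˣ) (hχcu : ∀ z, ‖((χc z : ℂˣ) : ℂ)‖ = 1)
    (hχcc : Continuous fun z => ((χc z : ℂˣ) : ℂ))
    (χ' : ((w : HeightOneSpectrum (𝓞 L)).adicCompletion L)ˣ →* ℂˣ)
    (hχ' : ∀ z : UnitaryGroup.localPi L (IsCMField.complexConj L) 1 JW v,
      χ' (Matrix.GeneralLinearGroup.det ((z : UnitaryGroup.LocalGLPi L 1 v) w)) = χc z)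
    {ϖ : (w : HeightOneSpectrum (𝓞 L)).adicCompletion L} (hϖ : IsUniformizingElement ϖ)
    {y : TwistedCoinv.Coinv
      (show Representation ℂ (UnitaryGroup.localPi L (IsCMField.complexConj L) 1 JW v)
          (SchwartzBruhat (Fin 2 → v.adicCompletion (maximalRealSubfield L))) from
        ((MpPsi.toRep (localSchrodinger (maximalRealSubfield L) 2 T₀ v)).comp s).comp
          (UnitaryGroup.localCenter L (IsCMField.complexConj L) 2
            (Matrix.reindex (finProdFinEquiv : Fin 2 × Fin 1 ≃ Fin 2) finProdFinEquiv (JV ⊗ₖ JW)) JW hJW0 v)) χc}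
    (hy : y ∈ Representation.fixedPoints
      ((TwistedCoinv.rep
        (ρW := show Representation ℂ (UnitaryGroup.localPi L (IsCMField.complexConj L) 1 JW v)
            (SchwartzBruhat (Fin 2 → v.adicCompletion (maximalRealSubfield L))) from
          ((MpPsi.toRep (localSchrodinger (maximalRealSubfield L) 2 T₀ v)).comp s).comp
            (UnitaryGroup.localCenter L (IsCMField.complexConj L) 2
              (Matrix.reindex (finProdFinEquiv : Fin 2 × Fin 1 ≃ Fin 2) finProdFinEquiv (JV ⊗ₖ JW)) JW hJW0 v))
        χc ((MpPsi.toRep (localSchrodinger (maximalRealSubfield L) 2 T₀ v)).comp s)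
        (fun g z => (show Commute g (UnitaryGroup.localCenter L (IsCMField.complexConj L) 2
            (Matrix.reindex (finProdFinEquiv : Fin 2 × Fin 1 ≃ Fin 2) finProdFinEquiv (JV ⊗ₖ JW)) JW hJW0 v z) from
          UnitaryGroup.localCenter_comm L (IsCMField.complexConj L) 2 _ JW hJW0 v z g).map
          ((MpPsi.toRep (localSchrodinger (maximalRealSubfield L) 2 T₀ v)).comp s))).comp
        (localLineInl L (IsCMField.complexConj L) 2 (finProdFinEquiv : Fin 2 × Fin 1 ≃ Fin 2) JV JW v))
      (UnitaryGroup.localInt L (IsCMField.complexConj L) 2 JV v)) :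
    heckeOperator
        ((TwistedCoinv.rep
          (ρW := show Representation ℂ (UnitaryGroup.localPi L (IsCMField.complexConj L) 1 JW v)
              (SchwartzBruhat (Fin 2 → v.adicCompletion (maximalRealSubfield L))) from
            ((MpPsi.toRep (localSchrodinger (maximalRealSubfield L) 2 T₀ v)).comp s).comp
              (UnitaryGroup.localCenter L (IsCMField.complexConj L) 2
                (Matrix.reindex (finProdFinEquiv : Fin 2 × Fin 1 ≃ Fin 2) finProdFinEquiv (JV ⊗ₖ JW)) JW hJW0 v))
          χc ((MpPsi.toRep (localSchrodinger (maximalRealSubfield L) 2 T₀ v)).comp s)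
          (fun g z => (show Commute g (UnitaryGroup.localCenter L (IsCMField.complexConj L) 2
              (Matrix.reindex (finProdFinEquiv : Fin 2 × Fin 1 ≃ Fin 2) finProdFinEquiv (JV ⊗ₖ JW)) JW hJW0 v z) from
            UnitaryGroup.localCenter_comm L (IsCMField.complexConj L) 2 _ JW hJW0 v z g).map
            ((MpPsi.toRep (localSchrodinger (maximalRealSubfield L) 2 T₀ v)).comp s))).comp
          (localLineInl L (IsCMField.complexConj L) 2 (finProdFinEquiv : Fin 2 × Fin 1 ≃ Fin 2) JV JW v))
        (UnitaryGroup.localInt L (IsCMField.complexConj L) 2 JV v)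
        ((UnitaryGroup.localPiSplitEquiv (IsCMField.complexConj L) JV hc1 hJVh w hw hJVw).symm
          (heckeDiag 2 (Units.mk0 ϖ hϖ.ne_zero) 1)) y =
        ((Real.sqrt (GaloisRepresentations.IsNonarchimedeanLocalField.residueFieldCard
            ((w : HeightOneSpectrum (𝓞 L)).adicCompletion L)) : ℂ) *
          ((((θ.localComponent (w : HeightOneSpectrum (𝓞 L))) (Units.mk0 ϖ hϖ.ne_zero) : ℂˣ) : ℂ) +
            ((χ' (Units.mk0 ϖ hϖ.ne_zero) : ℂˣ) : ℂ) *
              ((((θ.localComponent (w : HeightOneSpectrum (𝓞 L))) (Units.mk0 ϖ hϖ.ne_zero) : ℂˣ) : ℂ))⁻¹)) • y ∧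
      heckeOperator
        ((TwistedCoinv.rep
          (ρW := show Representation ℂ (UnitaryGroup.localPi L (IsCMField.complexConj L) 1 JW v)
              (SchwartzBruhat (Fin 2 → v.adicCompletion (maximalRealSubfield L))) from
            ((MpPsi.toRep (localSchrodinger (maximalRealSubfield L) 2 T₀ v)).comp s).comp
              (UnitaryGroup.localCenter L (IsCMField.complexConj L) 2
                (Matrix.reindex (finProdFinEquiv : Fin 2 × Fin 1 ≃ Fin 2) finProdFinEquiv (JV ⊗ₖ JW)) JW hJW0 v))
          χc ((MpPsi.toRep (localSchrodinger (maximalRealSubfield L) 2 T₀ v)).comp s)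
          (fun g z => (show Commute g (UnitaryGroup.localCenter L (IsCMField.complexConj L) 2
              (Matrix.reindex (finProdFinEquiv : Fin 2 × Fin 1 ≃ Fin 2) finProdFinEquiv (JV ⊗ₖ JW)) JW hJW0 v z) from
            UnitaryGroup.localCenter_comm L (IsCMField.complexConj L) 2 _ JW hJW0 v z g).map
            ((MpPsi.toRep (localSchrodinger (maximalRealSubfield L) 2 T₀ v)).comp s))).comp
          (localLineInl L (IsCMField.complexConj L) 2 (finProdFinEquiv : Fin 2 × Fin 1 ≃ Fin 2) JV JW v))
        (UnitaryGroup.localInt L (IsCMField.complexConj L) 2 JV v)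
        ((UnitaryGroup.localPiSplitEquiv (IsCMField.complexConj L) JV hc1 hJVh w hw hJVw).symm
          (heckeDiag 2 (Units.mk0 ϖ hϖ.ne_zero) 2)) y =
        ((χ' (Units.mk0 ϖ hϖ.ne_zero) : ℂˣ) : ℂ) • y := by
  subst hs
  refine ⟨heckeOperator_comp_localLineInl_apply_eq_smul₂ L (IsCMField.complexConj L) JW JV hc1 hJVh hJh w hw hJVw hJw _
      hJW0 _ _ (fun y' hy' => (splitPlace_heckeOperator_localInt_apply_localSplittingCM L hc1 T₀ hT₀ hT₀d t hT₀t _ hJ hJh v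
        w hw hJw θ hθ hθu JW hJW0 χc hχcu hχcc χ' hχ' hJi hϖ hy').1) hy,
    heckeOperator_comp_localLineInl_apply_eq_smul₂ L (IsCMField.complexConj L) JW JV hc1 hJVh hJh w hw hJVw hJw _
      hJW0 _ _ (fun y' hy' => (splitPlace_heckeOperator_localInt_apply_localSplittingCM L hc1 T₀ hT₀ hT₀d t hT₀t _ hJ hJh v
        w hw hJw θ hθ hθu JW hJW0 χc hχcu hχcc χ' hχ' hJi hϖ hy').2) hy⟩

end Literature.NumberTheory.Automorphic.Liu2021

end
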